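import Literature.ModelTheory.Zilber.EACDensityAligned
import HarnessLib

/-!
# Mantova–Masser's density question: constant fibres in the super-growth regime
# (`{x₁ = p(x₀), y₀ = c}` with `Re(a (2πiσ)^d) > 0`)

Eighth file of the `EACDensity*` series. For the surfaces `S_{p,c} = {x₁ = p(x₀), y₀ = c}`
(`deg p = d ≥ 2`, leading coefficient `a`, `c ≠ 0`; these lie in Mantova–Masser's case
(dim-pi-S-1-free)) the exponential points are EXPLICIT: `z_k = log c + 2πiσk` (`e^{z_k} = c`),
`y₁ = w_k = e^{p(z_k)}`. `EACDensityFamilies` decided density when `Re(a (σ i)^d) < 0` for a sign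
`σ` (then `w_k → 0` super-exponentially — the super-DECAY regime). Here the complementary open
regime `Re(a (σ i)^d) > 0` is settled: then `|w_k| → ∞` super-exponentially, and a REVERSED
Liouville elimination applies.

* `eq_zero_of_eval₂_eq_zero_of_supergrowth`: if `G ∈ ℂ[z][w]` vanishes at `(z_k, w_k)` with
  `‖z_k‖ → ∞`, `w_k ≠ 0`, `‖w_k‖⁻¹ ‖z_k‖^N → 0` (all `N`), then `G = 0` — apply the super-decay
  lemma `eq_zero_of_eval₂_eq_zero_of_superdecay` (`EACDensityQuestion`) to the reversed polynomial:
  `G^{rev}(z, w⁻¹) · w^{deg_w G} = G(z, w)` (`Polynomial.eval₂_reverse_mul_pow`).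
* `unprojectedDense_graphPolySurface_of_seq_growth`: the abstract density criterion for
  `graphPolySurface p q` in the growth regime.
* `re_eval_natCast_ge`: `Re Q(k) ≥ Re(a_Q) k^{deg Q} - (Σ‖Q^{erase}_i‖) k^{deg Q - 1}` for `k ≥ 1`.
* `exists_constSeq_growth`, `unprojectedDense_graphPolySurface_const_of_growth`,
  `unprojectedDensityQuestion_instance_constFibre_growth (hd : 2 ≤ p.natDegree) (hc : c ≠ 0)
   (σ : ℤ) (hσ : σ = 1 ∨ σ = -1) (hθ : 0 < Re(a (σ 2πi)^d)) :
   MMCaseDimPiOneFree (graphPolySurface p (C c)) ∧ UnprojectedDense (graphPolySurface p (C c))`.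
* Example: `{x₁ = -x₀², y₀ = 2}` — the points `(log 2 + 2πik, e^{-(log 2 + 2πik)²})` are Zariski
  dense in `ℂ²`.

## State of the graph families after this file

For `deg p ≥ 2`: non-constant `q` — ALL decided (`EACDensityCrossed`); constant `q = c ≠ 0` —
decided when `Re(a i^d) ≠ 0` or `Re(a (-i)^d) ≠ 0` (for `d` odd these are opposite numbers, so
only `Re(a i^d) = 0` escapes; for `d` even they coincide): super-decay (`EACDensityFamilies`) or
super-growth (this file). OPEN (oscillatory boundary): `Re(a i^d) = Re(a (-i)^d) = 0`, e.g.
`{x₁ = x₀³, y₀ = 1}`, where `|e^{p(z_k)}| = 1` along the exponential points and density would need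
an equidistribution / transcendence input. Also open: lines of real irrational slope, non-graph
shapes, and Mantova–Masser's question for a general surface of the case [MantovaMasser2023, §1
p. 5].

## Honest framing

Instances of an OPEN question; modest rungs of exponential-algebraic closedness for explicit
surfaces; `EC(3,2)` and Zilber's conjecture OPEN; nothing here bears on Schanuel's conjecture
(EAC does not imply SC); no statement of [MantovaMasser2023] is used as a hypothesis.
-/

noncomputable section

namespace Literature.ModelTheory.Zilber

open Filter Topology MvPolynomial Complex
open Literature.NumberTheory.Transcendental Literature.ModelTheory.ExponentialFields

variable (p q : Polynomial ℂ)

/-! ### Part 1 — Liouville elimination with super-growth in the fibre coordinate -/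

section Growth

/-- **Liouville lemma, super-growth form.** If `G ∈ ℂ[z][w]` vanishes at `(z_k, w_k)` with
`‖z_k‖ → ∞`, `w_k ≠ 0` and `‖w_k‖⁻¹ ‖z_k‖^N → 0` for every `N`, then `G = 0` (apply the
super-decay form `eq_zero_of_eval₂_eq_zero_of_superdecay` to the REVERSED polynomial at `w_k⁻¹`:
`G^rev(z, w⁻¹) w^{deg G} = G(z, w)`). (new in this file) [folklore] -/
theorem eq_zero_of_eval₂_eq_zero_of_supergrowth (G : Polynomial (Polynomial ℂ)) (z w : ℕ → ℂ)
    (hz : Tendsto (fun k => ‖z k‖) atTop atTop) (hw : ∀ k, w k ≠ 0)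
    (hgrow : ∀ N : ℕ, Tendsto (fun k => ‖(w k)⁻¹‖ * ‖z k‖ ^ N) atTop (𝓝 0))
    (hG : ∀ k, G.eval₂ (Polynomial.evalRingHom (z k)) (w k) = 0) : G = 0 := by
  have hrev : G.reverse = 0 := by
    refine eq_zero_of_eval₂_eq_zero_of_superdecay G.reverse z (fun k => (w k)⁻¹) hz
      (fun k => inv_ne_zero (hw k)) hgrow fun k => ?_
    letI : Invertible (w k) := invertibleOfNonzero (hw k)
    have key := Polynomial.eval₂_reverse_mul_pow (Polynomial.evalRingHom (z k)) (w k) G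
    rw [hG k, invOf_eq_inv, mul_eq_zero] at key
    exact key.resolve_right (pow_ne_zero _ (hw k))
  exact Polynomial.reverse_eq_zero.mp hrev

/-- **Abstract density criterion, super-growth form.** If `S_{p,q}` carries exponential points
`(z_k, p(z_k), q(w_k), w_k)` with `‖z_k‖ → ∞`, `w_k ≠ 0` and `‖w_k‖⁻¹ ‖z_k‖^N → 0` for every `N`,
then `I(S_{p,q} ∩ Γ_exp) = I(S_{p,q})`. (new in this file) [folklore] -/
theorem unprojectedDense_graphPolySurface_of_seq_growth (z w : ℕ → ℂ)
    (hz : Tendsto (fun k => ‖z k‖) atTop atTop) (hw : ∀ k, w k ≠ 0)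
    (hgrow : ∀ N : ℕ, Tendsto (fun k => ‖(w k)⁻¹‖ * ‖z k‖ ^ N) atTop (𝓝 0))
    (hexp₁ : ∀ k, exp (z k) = q.eval (w k)) (hexp₂ : ∀ k, exp (p.eval (z k)) = w k) :
    UnprojectedDense (graphPolySurface p q) := by
  refine le_antisymm ?_ (vanishingIdeal_anti_mono Set.inter_subset_left)
  intro F hF
  have hG0 : gpPullback p q F = 0 := by
    refine eq_zero_of_eval₂_eq_zero_of_supergrowth (gpPullback p q F) z w hz hw hgrow fun k => ?_
    rw [← mmEval_eq_eval₂, mmEval_gpPullback, ← coe_aeval_eq_eval]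
    exact (mem_vanishingIdeal_iff.mp hF) _
      ⟨gpParam_mem p q _ _, gpParam_mem_expGraph p q (hexp₁ k) (hexp₂ k)⟩
  rw [mem_vanishingIdeal_iff]
  intro s hs
  have h := mmEval_gpPullback p q F (s (Sum.inl 0)) (s (Sum.inr 1))
  rw [hG0, map_zero, ← eq_gpParam_of_mem p q hs] at h
  simpa [coe_aeval_eq_eval] using h.symm

end Growth

/-! ### Part 2 — constant fibres: the exponential points `z_k = log c + 2πiσk` and the growth of
`Re p(z_k)` -/

section ConstFibre

variable {p}

/-- Lower bound for the real part of a polynomial along an arithmetic progression: with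
`Q(x) = a_Q x^d + Q^erase(x)`, `θ = Re a_Q`, for real `k ≥ 1`,
`Re Q(k) ≥ θ k^d - (Σ‖Q^erase_i‖) k^{d-1}`. [folklore] -/
theorem re_eval_natCast_ge (Q : Polynomial ℂ) (k : ℕ) (hk : 1 ≤ k) :
    (Q.leadingCoeff).re * (k : ℝ) ^ Q.natDegree -
        coeffNormSum Q.eraseLead * (k : ℝ) ^ (Q.natDegree - 1) ≤ (Q.eval (k : ℂ)).re := by
  have hk1 : (1 : ℝ) ≤ k := by exact_mod_cast hk
  rw [eval_eq_eraseLead_add Q (k : ℂ), Complex.add_re]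
  have h1 : (Q.leadingCoeff * (k : ℂ) ^ Q.natDegree).re = Q.leadingCoeff.re * (k : ℝ) ^ Q.natDegree := by
    rw [← Complex.ofReal_natCast, ← Complex.ofReal_pow, Complex.re_mul_ofReal]
  have h2 : ‖Q.eraseLead.eval (k : ℂ)‖ ≤ coeffNormSum Q.eraseLead * (k : ℝ) ^ (Q.natDegree - 1) :=
    norm_eval_le_of_natDegree_le Q.eraseLead hk1 (by rw [Complex.norm_natCast])
      (Polynomial.eraseLead_natDegree_le Q)
  have h3 : -‖Q.eraseLead.eval (k : ℂ)‖ ≤ (Q.eraseLead.eval (k : ℂ)).re := by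
    have := Complex.abs_re_le_norm (Q.eraseLead.eval (k : ℂ))
    linarith [neg_abs_le (Q.eraseLead.eval (k : ℂ)).re]
  rw [h1]
  linarith

/-- **The super-growth sequence for a constant fibre.** Let `deg p = d ≥ 2` with leading
coefficient `a`, `c ≠ 0`, `σ = ±1` with `θ = Re(a (2πiσ)^d) > 0`. Along `z_k = log c + 2πiσ k`
one has `e^{z_k} = c` exactly, `‖z_k‖ → ∞`, and `w_k = e^{p(z_k)}` GROWS super-polynomially:
`‖w_k‖⁻¹ ‖z_k‖^N → 0` for every `N` (`Re p(z_k) ≥ θ k^d - O(k^{d-1})`).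
(new in this file) [folklore] -/
theorem exists_constSeq_growth (hd : 2 ≤ p.natDegree) (c : ℂ) (hc : c ≠ 0) (σ : ℤ)
    (hσ : σ = 1 ∨ σ = -1)
    (hθ : 0 < (p.leadingCoeff * ((σ : ℂ) * (2 * Real.pi * I)) ^ p.natDegree).re) :
    ∃ z w : ℕ → ℂ, Tendsto (fun j => ‖z j‖) atTop atTop ∧ (∀ j, w j ≠ 0) ∧
      (∀ N : ℕ, Tendsto (fun j => ‖(w j)⁻¹‖ * ‖z j‖ ^ N) atTop (𝓝 0)) ∧
      (∀ j, exp (z j) = c) ∧ ∀ j, exp (p.eval (z j)) = w j := by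
  set d : ℕ := p.natDegree with hd_def
  set a : ℂ := p.leadingCoeff with ha_def
  set L : ℂ := log c with hL_def
  set s : ℂ := (σ : ℂ) * (2 * Real.pi * I) with hs_def
  have hd1 : 1 ≤ d := le_trans (by norm_num) hd
  have hs_norm : ‖s‖ = 2 * Real.pi := by
    rw [hs_def]
    rcases hσ with rfl | rfl <;> simp [abs_of_pos Real.pi_pos]
  have hs0 : s ≠ 0 := by
    rw [← norm_pos_iff, hs_norm]; positivity
  -- `Q(x) = p(s x + L)`
  set lin : Polynomial ℂ := Polynomial.C s * Polynomial.X + Polynomial.C L with hlin_def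
  set Q : Polynomial ℂ := p.comp lin with hQ_def
  have hQeval : ∀ x : ℂ, Q.eval x = p.eval (s * x + L) := by
    intro x; simp [hQ_def, hlin_def, Polynomial.eval_comp]
  have hlin_nat : lin.natDegree = 1 := by
    rw [hlin_def, Polynomial.natDegree_add_C, Polynomial.natDegree_C_mul_X _ hs0]
  have hlin_lc : lin.leadingCoeff = s := by
    rw [hlin_def, Polynomial.leadingCoeff_add_of_degree_lt', Polynomial.leadingCoeff_C_mul_X]
    rw [Polynomial.degree_C_mul_X hs0]
    exact lt_of_le_of_lt Polynomial.degree_C_le (by exact_mod_cast Nat.zero_lt_one)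
  have hQnat : Q.natDegree = d := by
    rw [hQ_def, Polynomial.natDegree_comp, hlin_nat, mul_one]
  have hQlc : Q.leadingCoeff = a * s ^ d := by
    rw [hQ_def, Polynomial.leadingCoeff_comp (by rw [hlin_nat]; exact one_ne_zero), hlin_lc]
  set θ : ℝ := (a * s ^ d).re with hθ_def
  set C₃ : ℝ := coeffNormSum Q.eraseLead with hC₃
  have hC₃0 : 0 ≤ C₃ := coeffNormSum_nonneg _
  -- the sequence and the growth exponent
  set zk : ℕ → ℂ := fun k => s * (k : ℂ) + L with hzk
  have hK_ge : ∀ k : ℕ, 1 ≤ k → θ * (k : ℝ) ^ d - C₃ * (k : ℝ) ^ (d - 1) ≤ (p.eval (zk k)).re := by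
    intro k hk
    have := re_eval_natCast_ge Q k hk
    rw [hQnat, hQlc, hQeval] at this
    exact this
  -- eventual conditions
  have hev₁ : ∀ᶠ k : ℕ in atTop, C₃ + 2 * Real.pi + 1 ≤ θ * k :=
    (tendsto_natCast_atTop_atTop.const_mul_atTop hθ).eventually_ge_atTop _
  have hev₂ : ∀ᶠ k : ℕ in atTop, ‖L‖ ≤ (k : ℝ) := tendsto_natCast_atTop_atTop.eventually_ge_atTop _
  have hev₃ : ∀ᶠ k : ℕ in atTop, 1 ≤ k := eventually_ge_atTop 1
  obtain ⟨K₀, hK₀⟩ := eventually_atTop.1 (hev₁.and (hev₂.and hev₃))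
  -- the growth estimate at stage k ≥ K₀: Re p(z_k) ≥ (2π + 1) k ≥ ‖z_k‖ and ≥ k
  have hmain : ∀ k : ℕ, K₀ ≤ k →
      (2 * Real.pi + 1) * k ≤ (p.eval (zk k)).re ∧ ‖zk k‖ ≤ (p.eval (zk k)).re := by
    intro k hk
    obtain ⟨h1, h2, h3⟩ := hK₀ k hk
    have hk1 : (1 : ℝ) ≤ k := by exact_mod_cast h3
    have hk0 : (0 : ℝ) ≤ k := by linarith
    have hpow : (k : ℝ) ≤ (k : ℝ) ^ (d - 1) := le_self_pow₀ hk1 (by omega)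
    have hpd : (k : ℝ) ^ d = (k : ℝ) ^ (d - 1) * k := by
      rw [← pow_succ]; congr 1; omega
    have hge := hK_ge k h3
    have hstep : (2 * Real.pi + 1) * k ≤ θ * (k : ℝ) ^ d - C₃ * (k : ℝ) ^ (d - 1) := by
      rw [hpd]
      have h4 : (2 * Real.pi + 1) * (k : ℝ) ≤ (θ * k - C₃) * k := by nlinarith
      have h5 : (θ * k - C₃) * (k : ℝ) ≤ (θ * k - C₃) * (k : ℝ) ^ (d - 1) :=
        mul_le_mul_of_nonneg_left hpow (by linarith [Real.pi_pos])
      nlinarith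
    have hnorm : ‖zk k‖ ≤ 2 * Real.pi * k + ‖L‖ := by
      show ‖s * (k : ℂ) + L‖ ≤ _
      refine (norm_add_le _ _).trans ?_
      rw [norm_mul, hs_norm, Complex.norm_natCast]
    constructor
    · linarith
    · linarith
  refine ⟨fun j => zk (j + K₀), fun j => exp (p.eval (zk (j + K₀))), ?_, fun j => exp_ne_zero _,
    ?_, fun j => ?_, fun j => rfl⟩
  · -- ‖z_j‖ → ∞
    refine tendsto_norm_atTop_of_le ((tendsto_natCast_add_atTop (K₀ : ℝ)))
      (a := 2 * Real.pi) (b := 2 * ‖L‖) (by positivity) fun j => ?_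
    show 2 * Real.pi * ((j : ℝ) + K₀) - 2 * ‖L‖ ≤ ‖s * ((j + K₀ : ℕ) : ℂ) + L‖
    have h := norm_sub_norm_le (s * ((j + K₀ : ℕ) : ℂ)) (-L)
    rw [sub_neg_eq_add, norm_neg, norm_mul, hs_norm, Complex.norm_natCast] at h
    push_cast at h ⊢
    linarith [norm_nonneg L]
  · -- super-polynomial growth, scale `K_j = Re p(z_{j+K₀})`
    intro N
    have hK : Tendsto (fun j => (p.eval (zk (j + K₀))).re) atTop atTop := by
      refine tendsto_atTop_mono (fun j => ?_)
        ((tendsto_natCast_add_atTop (K₀ : ℝ)).const_mul_atTop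
          (by positivity : (0 : ℝ) < 2 * Real.pi + 1))
      have := (hmain (j + K₀) (Nat.le_add_left _ _)).1
      push_cast at this
      exact this
    refine superdecay_of_le hK (A := 1) (fun j => ?_) (fun j => ?_) N
    · rw [one_mul]; exact (hmain (j + K₀) (Nat.le_add_left _ _)).2
    · rw [← Complex.exp_neg, Complex.norm_exp, Complex.neg_re]
  · -- `e^{z_j} = c`
    show exp (s * ((j + K₀ : ℕ) : ℂ) + L) = c
    rw [Complex.exp_add, hL_def, exp_log hc, hs_def,
      (show (σ : ℂ) * (2 * Real.pi * I) * ((j + K₀ : ℕ) : ℂ) =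
        ((σ * (j + K₀ : ℕ) : ℤ) : ℂ) * (2 * Real.pi * I) by push_cast; ring),
      Complex.exp_int_mul_two_pi_mul_I, one_mul]

/-- **Density for constant fibres in the super-growth regime.** If `deg p ≥ 2`, `c ≠ 0` and
`Re(a (2πiσ)^d) > 0` for `σ = 1` or `σ = -1`, then `I(S_{p,c} ∩ Γ_exp) = I(S_{p,c})` for
`S_{p,c} = {x₁ = p(x₀), y₀ = c}`: the exponential points `(log c + 2πiσk, ·, c, e^{p(log c + 2πiσk)})`
are Zariski dense. (new in this file) [folklore] -/
theorem unprojectedDense_graphPolySurface_const_of_growth (hd : 2 ≤ p.natDegree) {c : ℂ}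
    (hc : c ≠ 0) (σ : ℤ) (hσ : σ = 1 ∨ σ = -1)
    (hθ : 0 < (p.leadingCoeff * ((σ : ℂ) * (2 * Real.pi * I)) ^ p.natDegree).re) :
    UnprojectedDense (graphPolySurface p (Polynomial.C c)) := by
  obtain ⟨z, w, hz, hw, hgrow, h₁, h₂⟩ := exists_constSeq_growth hd c hc σ hσ hθ
  exact unprojectedDense_graphPolySurface_of_seq_growth p (Polynomial.C c) z w hz hw hgrow
    (fun k => by rw [Polynomial.eval_C]; exact h₁ k) h₂

/-- **Mantova–Masser's question for constant fibres, super-growth regime**: case certificate and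
density together. Combined with `EACDensityFamilies` (the super-DECAY regime
`Re(a (σ i)^d) < 0`), constant fibres `{x₁ = p(x₀), y₀ = c}` (`deg p ≥ 2`, `c ≠ 0`) are decided
unless `Re(a i^d) = Re(a (-i)^d) = 0` (the oscillatory boundary, e.g. `{x₁ = x₀³, y₀ = 1}`,
which stays OPEN here). (new in this file) [folklore] -/
theorem unprojectedDensityQuestion_instance_constFibre_growth (hd : 2 ≤ p.natDegree) {c : ℂ}
    (hc : c ≠ 0) (σ : ℤ) (hσ : σ = 1 ∨ σ = -1)
    (hθ : 0 < (p.leadingCoeff * ((σ : ℂ) * (2 * Real.pi * I)) ^ p.natDegree).re) :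
    MMCaseDimPiOneFree (graphPolySurface p (Polynomial.C c)) ∧
      UnprojectedDense (graphPolySurface p (Polynomial.C c)) :=
  ⟨mmCase_graphPolySurface_of_two_le hd (by rwa [Ne, Polynomial.C_eq_zero]),
    unprojectedDense_graphPolySurface_const_of_growth hd hc σ hσ hθ⟩

/-- Example: `{x₁ = -x₀², y₀ = 2}` — the points `(log 2 + 2πik, e^{-(log 2 + 2πik)²})` are Zariski
dense in `ℂ²` (here `Re(-(2πi)²) = 4π² > 0`; the super-decay criterion of `EACDensityFamilies`
fails for this base). [folklore] -/
example : MMCaseDimPiOneFree (graphPolySurface (-Polynomial.X ^ 2) (Polynomial.C 2)) ∧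
    UnprojectedDense (graphPolySurface (-Polynomial.X ^ 2) (Polynomial.C 2)) := by
  have hd : (-Polynomial.X ^ 2 : Polynomial ℂ).natDegree = 2 := by
    rw [Polynomial.natDegree_neg, Polynomial.natDegree_X_pow]
  have ha : (-Polynomial.X ^ 2 : Polynomial ℂ).leadingCoeff = -1 := by
    rw [Polynomial.leadingCoeff_neg, Polynomial.leadingCoeff_X_pow]
  refine unprojectedDensityQuestion_instance_constFibre_growth (by rw [hd]) two_ne_zero 1
    (Or.inl rfl) ?_
  rw [hd, ha]
  push_cast
  have hI : I ^ 2 = -1 := Complex.I_sq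
  have : (-1 : ℂ) * (1 * (2 * (Real.pi : ℂ) * I)) ^ 2 = ((4 * Real.pi ^ 2 : ℝ) : ℂ) := by
    push_cast; linear_combination (-4 * (Real.pi : ℂ) ^ 2) * hI
  rw [this, Complex.ofReal_re]
  positivity

end ConstFibre

end Literature.ModelTheory.Zilber

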